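import Summits.HodgeConjecture.HodgeConjecture.Theorems.F0P6aStubFROBStubs
import Summits.HodgeConjecture.HodgeConjecture.Theorems.F0P6aStubRHO1
import HarnessLib

/-!
# `F0P6aStubFROBCanSP` — ★ RE-HOME of `Lines/F0_P6a_StubFROB.lean` (tree ED. 5 sha16 f9174234eccff5e5), PART 2 of 3 — tree lines :301–:370 (MIDDLE part, «M-150j» EARLY SPLIT, LEAD F0P6-plan (g7) 03:40Z 09-03 ∕ dealer LA3-plan (g6): the (QUOTWD)∕(CANSP) organ block `stub_QUOTWD` ∕ `stub_CANSP` ∕ `roof0_of_cansp_geo` — the FIRST reader of ★ `Theorems.F0P6aStubRHO1` ((ρ1𝒞) head `…F0P6aLineSpecialisation.exists_quotLegReduction`), which is therefore imported HERE and not in PART 1).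

See PART 1 `Theorems/F0P6aStubFROBStubs.lean` for the full ★ re-home header and the original module docstring (verbatim there).  Same namespace (every fully-qualified name unchanged);
the scopes open at the cut (`noncomputable section` ∕ `namespace` ∕ `section`s) are re-opened below with their `variable` ∕ `open` ∕ `set_option` ∕ `omit` ∕ `include` ∕ `universe` lines
replayed verbatim from the tree, in order; the code after the replay block is the tree bytes :301–:370, untouched.  HC_CM is proved only modulo the 7 printed citations (2 remaining: hLiu418 = stmt-HodgeConjecture-24832, h413 = stmt-HodgeConjecture-24833) until rung 0 closes; a re-home is count-neutral.
-/

-- ── replay of the scopes open at tree line :301 (verbatim) ──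
set_option autoImplicit false
set_option linter.dupNamespace false
noncomputable section
namespace Summit.HodgeConjecture.HodgeConjecture.Cruxes.HLiu418.F0P6aStubFROB
open CategoryTheory CategoryTheory.Limits NumberField IsDedekindDomain MulAction
open scoped Matrix Polynomial Pointwise MonoidalCategory
open Literature.NumberTheory.GaloisRepresentations
open Literature.NumberTheory.Automorphic Literature.NumberTheory.Automorphic.UnitaryGroup
open Literature.AlgebraicGeometry.ShimuraVarieties.UnitaryCanonicalModel
open Literature.NumberTheory.Automorphic.Liu2021.AppendixC
open Literature.AlgebraicGeometry.Motives (AlgPoints IntegralModel SchemeOver thickening thickeningGalAction thickeningLift specOver relFrobeniusOver frobeniusTwistOver frobSpec)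
open Literature.NumberTheory.DiophantineGeometry (geomResidueField specialFibreFunctor specResidueField)
open Literature.AlgebraicGeometry.RelativeSpec (ActionOver)
open Literature.NumberTheory.EllipticCurves (genericFibre)
open Summit.HodgeConjecture.HodgeConjecture.Cruxes.HLiu418.F0P6aModuliDatumDefs
open Summit.HodgeConjecture.HodgeConjecture.Cruxes.HLiu418.F0P6aRGDAssembly
open Summit.HodgeConjecture.HodgeConjecture.Cruxes.HLiu418.F0P6aDatumOfInputs
open Summit.HodgeConjecture.HodgeConjecture.Cruxes.HLiu418.F0P6aLineSpecialisation (spGeoOf canonicalLine_spGeoOf natCard_lineOf_eq_succ)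
section Stubs
variable {F : Type} [Field F] [NumberField F] [IsCMField F] [IsGalois ℚ F] {ι₁ : F →+* ℂ}
    {Jstar : Matrix (Fin 2) (Fin 2) F}
    {K₀ : C5.OpenCompactSubgroup ↥(finAdelic ↥(maximalRealSubfield F) F (IsCMField.complexConj F) 2 Jstar)}
    {S : RecordSystemGS F Jstar ι₁ K₀} {hU7ₛ : S.HeckeTranslateDefinedOver}
    {hJ : (Jstar.map (IsCMField.complexConj F))ᵀ = Jstar} {hJu : IsUnit Jstar}
    {Fi : Type} [Field Fi] [Algebra F Fi] [FiniteDimensional F Fi] [IsGalois F Fi] {Kc : C5.SmallLevel K₀} {G : Type} [Group G] [Finite G]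
    {𝓜 : IntegralModel (𝓞 F) F ((thickening F Fi).obj (S.M.obj Kc))}
    {w : HeightOneSpectrum (𝓞 F)} {hw : (IsCMField.complexConj F) • w ≠ w} {h𝓨 : (𝓜.localise w).IsSmoothProper 1}
    {θ : ActionOver (𝓜.localise w).total.hom ((Fi ≃ₐ[F] Fi) × G)}
    {e : Fi →ₐ[F] AlgebraicClosure (w.adicCompletion F)}
-- ── tree bytes :301–:370 ──

/-! ### ED. 3 «STATE-2» — the split `stub_ROOF0 ↦ {stub_CANSP (⇐ stub_QUOTWD), stub_ROOFGEO}` along ★ p848314 `canonicalLine_transfer_of_red_quotΩ` (LA3-plan (g2) pen;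
A-p03 (g31) §CanonicalLine above; LS leaflet `Lines/F0_P6a_LineSpecialisation.lean` ED. 2 feeds `spGeoOf` ∕ `canonicalLine_spGeoOf` ∕ `natCard_lineOf_eq_succ` by import) -/

set_option maxHeartbeats 400000 in
set_option linter.unusedSectionVars false in  -- ED. 5: the `Stubs`-section instances stay in the Π-type (byte-frozen); `[IsGalois ℚ F]` is consumed by `exists_quotLegReduction`, the other three are unused by the term proof (as ED. 2 did for `stub_COV0`)
/-- (QUOTWD) **QUOTIENT REDUCTION IS WELL DEFINED ON THE GEOMETRIC SPECIALISATION** — L2's (ρ2) `QuotWellDefLaw` read at `sp := spGeoOf I 𝔡`: two lines over `y` with the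
same geometric specialisation have moduli quotients with the same reduction.  ORGAN (L2-fed: LS leaflet ED. ≥ 3 (ρ2) head, LA6-p01; bricks ★ (ISO-q) ★ (BLK) ★ (W-λ H1) ★ (H2)
★ (ρ2″); (e1) `I.hunr`, `hdeg` from the roof rows).  The `hwd₂` feed of `canSP_of_laws`. [cite: Liu2021, Prop. D.8 (2)–(3) p. 135, p. 137] [cite: SerreTate1968, §1 Lemma 2] -/
theorem stub_QUOTWD (I : RGDInputsAt F ι₁ Jstar K₀ S hU7ₛ hJ hJu Fi Kc G 𝓜 w hw h𝓨 θ e) [ExpChar (geomResidueField w) I.pChar]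
    (𝔡 : ∀ xbar, DockAt I xbar)
    (quotΩ : ∀ y, LineOf I y → AlgPoints (S.M.obj Kc) (AlgebraicClosure (w.adicCompletion F)))
    (translΩ : AlgPoints (S.M.obj Kc) (AlgebraicClosure (w.adicCompletion F)) → AlgPoints (S.M.obj Kc) (AlgebraicClosure (w.adicCompletion F)))
    (_hhecke : HeckeClause I quotΩ translΩ) (_hroof : RoofLink I quotΩ) (_hroof₂ : RoofLink₂ I translΩ) (𝔯 : DownReadings I 𝔡 quotΩ translΩ)
    (_hunit : (UnitaryGroup.isUnit_placeForm Jstar hJu w).unit ∈ glInt 2 (w.adicCompletion F))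
    (_hKc : UnitaryGroup.IsHyperspecialAt ↥(maximalRealSubfield F) F (IsCMField.complexConj F) 2 Jstar Kc.1.1
      (w.under (𝓞 ↥(maximalRealSubfield F))))
    (_hdisj : haveI : AlgebraicGeometry.IsProper (𝓜.localise w).total.hom := h𝓨.2
      ∀ (β : Fi ≃ₐ[F] Fi) (P Q : AlgPoints (S.M.obj Kc) (AlgebraicClosure (w.adicCompletion F))),
        (𝓜.localise w).geomReductionMap (thickeningLift e (S.M.obj Kc) P) =
          AlgPoints.map ((specialFibreFunctor w).map (Over.isoMk (θ.aut (β, 1)) (θ.aut_comp (β, 1))).hom :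
              (𝓜.localise w).reductionAt ⟶ (𝓜.localise w).reductionAt)
            ((𝓜.localise w).geomReductionMap (thickeningLift e (S.M.obj Kc) Q)) → β = 1) :
    ∀ y (L L' : LineOf I y), spGeoOf I 𝔡 y L = spGeoOf I 𝔡 y L' →
      red₀Of S Kc 𝓜 w h𝓨 e (quotΩ y L) = red₀Of S Kc 𝓜 w h𝓨 e (quotΩ y L') := by
  -- ED. 5: PAID by the W6 leaflet head (W6″) fed with L2՚s (ρ1𝒞) head BY TYPE (ONE name: (W4b) `exists_quotLegReduction`, ns `…F0P6aLineSpecialisation`)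
  exact Summit.HodgeConjecture.HodgeConjecture.Cruxes.HLiu418.F0P6aStubFROBQuotWD.quotwd_of_exists_quotLegReduction I 𝔡 quotΩ translΩ _hhecke _hroof _hroof₂ 𝔯 _hunit _hKc _hdisj
    (Summit.HodgeConjecture.HodgeConjecture.Cruxes.HLiu418.F0P6aLineSpecialisation.exists_quotLegReduction I)

set_option maxHeartbeats 400000 in
set_option linter.unusedSectionVars false in
/-- (CANSP) **THE CANONICAL-LINE TRANSFER** — PAID: `canSP_of_laws` (★ p848314 `canonicalLine_transfer_of_red_quotΩ`) fed by the LS leaflet's `spGeoOf` ∕ `canonicalLine_spGeoOf`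
∕ `natCard_lineOf_eq_succ` and the organ `stub_QUOTWD`: every line canonical for the READING `𝔯.spec.sp` has a GEOMETRICALLY canonical companion with the same quotient reduction.
[cite: Liu2021, Prop. D.8 (3) p. 135, pp. 137–138] [cite: Carayol1986Compositio, §10.3 Prop. p. 211] -/
theorem stub_CANSP (I : RGDInputsAt F ι₁ Jstar K₀ S hU7ₛ hJ hJu Fi Kc G 𝓜 w hw h𝓨 θ e) [ExpChar (geomResidueField w) I.pChar]
    (𝔡 : ∀ xbar, DockAt I xbar)
    (quotΩ : ∀ y, LineOf I y → AlgPoints (S.M.obj Kc) (AlgebraicClosure (w.adicCompletion F)))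
    (translΩ : AlgPoints (S.M.obj Kc) (AlgebraicClosure (w.adicCompletion F)) → AlgPoints (S.M.obj Kc) (AlgebraicClosure (w.adicCompletion F)))
    (_hhecke : HeckeClause I quotΩ translΩ) (_hroof : RoofLink I quotΩ) (_hroof₂ : RoofLink₂ I translΩ) (𝔯 : DownReadings I 𝔡 quotΩ translΩ)
    (_hunit : (UnitaryGroup.isUnit_placeForm Jstar hJu w).unit ∈ glInt 2 (w.adicCompletion F))
    (_hKc : UnitaryGroup.IsHyperspecialAt ↥(maximalRealSubfield F) F (IsCMField.complexConj F) 2 Jstar Kc.1.1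
      (w.under (𝓞 ↥(maximalRealSubfield F))))
    (_hdisj : haveI : AlgebraicGeometry.IsProper (𝓜.localise w).total.hom := h𝓨.2
      ∀ (β : Fi ≃ₐ[F] Fi) (P Q : AlgPoints (S.M.obj Kc) (AlgebraicClosure (w.adicCompletion F))),
        (𝓜.localise w).geomReductionMap (thickeningLift e (S.M.obj Kc) P) =
          AlgPoints.map ((specialFibreFunctor w).map (Over.isoMk (θ.aut (β, 1)) (θ.aut_comp (β, 1))).hom :
              (𝓜.localise w).reductionAt ⟶ (𝓜.localise w).reductionAt)
            ((𝓜.localise w).geomReductionMap (thickeningLift e (S.M.obj Kc) Q)) → β = 1) :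
    ∀ y (L : LineOf I y), 𝔯.spec.sp y L = kerFOf I 𝔡 (red₀Of S Kc 𝓜 w h𝓨 e y) →
      ∃ L' : LineOf I y, spGeoOf I 𝔡 y L' = kerFOf I 𝔡 (red₀Of S Kc 𝓜 w h𝓨 e y) ∧
        red₀Of S Kc 𝓜 w h𝓨 e (quotΩ y L') = red₀Of S Kc 𝓜 w h𝓨 e (quotΩ y L) :=
  fun y L hsp => canSP_of_laws I 𝔡 quotΩ translΩ 𝔯 (spGeoOf I 𝔡) (canonicalLine_spGeoOf I 𝔡)
    (stub_QUOTWD I 𝔡 quotΩ translΩ _hhecke _hroof _hroof₂ 𝔯 _hunit _hKc _hdisj) (natCard_lineOf_eq_succ I 𝔡) y L hsp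

set_option maxHeartbeats 400000 in
set_option linter.unusedSectionVars false in
/-- (GLUE) **A ROOF LAW AT ONE READING TRANSFERS TO ANY READING WITH CANONICAL COMPANIONS**: `Quot₀RoofLaw` depends on the line `L` only through the point
`red₀ (quotΩ y L)`. Sorry-free. [cite: Liu2021, Prop. D.8 (3) p. 135] -/
theorem roof0_of_cansp_geo (I : RGDInputsAt F ι₁ Jstar K₀ S hU7ₛ hJ hJu Fi Kc G 𝓜 w hw h𝓨 θ e) [ExpChar (geomResidueField w) I.pChar]
    (𝔡 : ∀ xbar, DockAt I xbar)
    (quotΩ : ∀ y, LineOf I y → AlgPoints (S.M.obj Kc) (AlgebraicClosure (w.adicCompletion F)))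
    {sp spGeo : ∀ y, LineOf I y → SubOf I 𝔡 (red₀Of S Kc 𝓜 w h𝓨 e y)} {frobIdeal : (Fi ≃ₐ[F] Fi) → Ideal (𝓞 F)}
    (hC : ∀ y (L : LineOf I y), sp y L = kerFOf I 𝔡 (red₀Of S Kc 𝓜 w h𝓨 e y) →
      ∃ L' : LineOf I y, spGeo y L' = kerFOf I 𝔡 (red₀Of S Kc 𝓜 w h𝓨 e y) ∧
        red₀Of S Kc 𝓜 w h𝓨 e (quotΩ y L') = red₀Of S Kc 𝓜 w h𝓨 e (quotΩ y L))
    (hG : Quot₀RoofLaw I 𝔡 quotΩ spGeo frobIdeal) : Quot₀RoofLaw I 𝔡 quotΩ sp frobIdeal := by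
  intro σ hσ γ hγ y L hsp
  obtain ⟨L', hL', hred⟩ := hC y L hsp
  rw [← hred]
  exact hG σ hσ γ hγ y L' hL'


/-! (★ re-home, size lint + «M-150j» early split: PART 2 of 3 ends here at tree line :370; the workfile continues, in the same namespace, in `Theorems/F0P6aStubFROB.lean`.) -/

end Stubs
end Summit.HodgeConjecture.HodgeConjecture.Cruxes.HLiu418.F0P6aStubFROB
end
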